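import Literature.Probability.LatticeModels.TriangularLattice
import Literature.Probability.LatticeModels.PolylineWinding
import Mathlib.Data.Fintype.List
import HarnessLib

/-!
# The parafermionic observable of the self-avoiding walk on the hexagonal lattice

Topic `Literature/Probability/RandomPlanarGeometry`; definition request
`defn-HexParafermionicObservable` (consumers: Duminil-Copin–Smirnov 2012 Lemma 1 — the vertex
relation, a provable finite identity, recorded below as the named fact
`DuminilCopinSmirnov2012_lemma1` — and Conjecture 2, item `wi-04959`; routes
`CriticalPhenomena/SAWScalingLimit/{SAWParafermion, SAWHexUniversality}`).

Source: H. Duminil-Copin, S. Smirnov, *The connective constant of the honeycomb lattice equals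
`√(2+√2)`*, Ann. of Math. 175 (2012) 1653–1665 (arXiv:1007.0575), §1–§2 (pp. 2–4 of the
arXiv version):

* (§1, p. 2) "It will be convenient to consider walks between mid-edges of `ℍ`, i.e. centers of
  edges of `ℍ` … We will write `γ : a → E` if a walk `γ` starts at `a` and ends at some mid-edge
  of `E` … The length `ℓ(γ)` of the walk is the number of vertices visited by `γ`."
* (§2, p. 2) "A (hexagonal lattice) domain `Ω ⊂ H` is a union of all mid-edges emanating from a
  given collection of vertices `V(Ω)`: a mid-edge `z` belongs to `Ω` if at least one end-point
  of its associated edge is in `Ω`, it belongs to `∂Ω` if only one of them is in `Ω`. We further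
  assume `Ω` to be simply connected, i.e. having a connected complement."
* "For a self-avoiding walk `γ` between mid-edges `a` and `b` …, we define its winding
  `W_γ(a, b)` as the total rotation of the direction in radians when `γ` is traversed from `a`
  to `b`."
* Definition 1: "The parafermionic observable for `a ∈ ∂Ω`, `z ∈ Ω`, is defined by
  `F(z) = F(a, z, x, σ) = Σ_{γ ⊂ Ω : a → z} e^{-iσ W_γ(a,z)} x^{ℓ(γ)}`."
* Lemma 1: "If `x = x_c` and `σ = 5/8`, then `F` satisfies the following relation for every
  vertex `v ∈ V(Ω)`: `(p - v)F(p) + (q - v)F(q) + (r - v)F(r) = 0`, where `p, q, r` are the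
  mid-edges of the three edges adjacent to `v`." (`x_c := 1/√(2+√2)`, §1.)

## Contents (namespace `Literature.SAW`)

The hexagonal lattice `ℍ` is `hexGraph` on `HexVertex` (the faces of the triangular lattice
`𝕋`), embedded in `ℂ` by `hexCenter` (`TriangularLattice.lean`); a mid-edge is an unordered pair
`e : Sym2 HexVertex` with `e ∈ hexGraph.edgeSet`, embedded at `hexMidpoint e`.

* `hexMidpoint e` — the centre of the edge `e`.
* `hexDomainMidEdges Λ = Ω`, `hexDomainBoundary Λ = ∂Ω` for the vertex set `Λ = V(Ω)`;
  `hexDomainSimplyConnected Λ` — "connected complement".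
* `HexMidEdgeSAW Λ a z` — the self-avoiding walks `γ ⊂ Ω : a → z` between the mid-edges `a`
  and `z`, encoded by the list `verts = [v₁, …, vₙ]` of visited vertices (`n = ℓ(γ) ≥ 0`):
  the walk runs `mid(a) → v₁ → v₂ → ⋯ → vₙ → mid(z)` along edges of `ℍ`; the `vᵢ ∈ Λ` are
  pairwise distinct and consecutive ones adjacent, `v₁ ∈ a`, `vₙ ∈ z`, no edge is used twice
  (in particular no U-turn on `a`, on `z`, or `a = z` with `n ≥ 1`), and `n = 0` forces `a = z`
  (the trivial walk). `length = ℓ(γ)`, `points` (the polyline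
  `mid(a), c(v₁), …, c(vₙ), mid(z)`), `winding = W_γ(a, z)` (via `Literature.Probability.LatticeModels.winding`: the sum
  of the signed turning angles, here `n` turns of `±π/3`), `weight x σ = e^{-iσW} x^ℓ`.
* **`hexParafermionicObservable Λ a x σ z = F(a, z, x, σ)`** (Definition 1), a finite sum
  (`Fintype (HexMidEdgeSAW Λ a z)`).
* NAMED FACT `DuminilCopinSmirnov2012_lemma1` (the vertex relation (1)) as a `def : Prop`.
* API: `hexParafermionicObservable_self` (`F(a) = 1` for `a ∈ ∂Ω`: only the trivial walk),
  `norm_weight`, `norm_hexParafermionicObservable_le` (`|F(z)| ≤ Σ_γ x^{ℓ(γ)}` for `x ≥ 0`),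
  `hexParafermionicObservable_zero_spin` (`σ = 0`: the generating function `Σ x^ℓ`).

## Design choices and wording risks

* MID-EDGE WALKS AS VERTEX LISTS. A walk between mid-edges is determined by its two end
  mid-edges and the ordered list of visited vertices; this avoids dependent `SimpleGraph.Walk`
  endpoints and represents the trivial walk (`ℓ = 0`, present iff `a = z`) uniformly. A walk
  may END at a mid-edge `z = {vₙ, w}` whose far endpoint `w` was visited earlier (it only covers
  the `vₙ`-half of `z`); these are exactly the walks "visiting all three mid-edges" around `w`
  that DCS pair up in the proof of Lemma 1, so they must be admitted. Re-using an edge (list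
  `a, {v₁,v₂}, …, {vₙ₋₁,vₙ}, z` with a repetition) is excluded; given distinct vertices this only
  forbids U-turns on `a` or `z` and closed walks `a → a` of positive length (junk regime: DCS
  take `a ∈ ∂Ω`, where such walks do not exist, `verts_eq_nil_of_mem_boundary`).
* WINDING is computed geometrically from the embedded polyline (`Literature.Probability.LatticeModels.turning` =
  `arg` of the ratio of consecutive increments), exactly "the total rotation of the direction in
  radians"; at each hexagonal vertex the turn is `±π/3`, and the first/last half-segments are
  parallel to the edges `a`, `z`, so no turn is lost. It is scale invariant, hence serves the
  rescaled domains `Ω_δ ⊂ δℍ` of Conjecture 2 unchanged.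
* `F` is defined for all `a`, `z` (DCS: `a ∈ ∂Ω`, `z ∈ Ω`); walks exist only if
  `a ∈ hexDomainMidEdges Λ` (a field), and then `z ∈ Ω` automatically unless `ℓ = 0`.
* The domain is a `Finset` of vertices (DCS's `F` lives in bounded domains; the strip `S_T` of
  §3 enters only through its truncations `S_{T,L}`), which makes `F` a genuine finite sum.
* "Simply connected, i.e. having a connected complement": the subgraph of `ℍ` induced on
  `Λᶜ` is preconnected (it is infinite, hence nonempty, `Λ` being finite).
* Lemma 1 is vendored with `x_c = (√(2+√2))⁻¹` written out (it is `hexCriticalFugacity` of the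
  sibling file `HexSAW.lean`, request `defn-HexSAWLaw`, not imported here) and with the three
  neighbours `p, q, r` of `v` quantified as pairwise distinct neighbours (every vertex of `ℍ` has
  exactly three, `card_neighborSet_hexGraph`); mid-edges and `v` enter (1) through their
  embedded positions `hexMidpoint`, `hexCenter`.
-/

noncomputable section

open Literature.Probability.LatticeModels Literature.Probability.Percolation

namespace Literature.Probability.RandomPlanarGeometry.SAW

/-! ### Mid-edges and hexagonal-lattice domains -/

/-- The centre of the edge `e = {f, g}` of the hexagonal lattice (a *mid-edge* when
`e ∈ hexGraph.edgeSet`): the midpoint of `hexCenter f` and `hexCenter g`.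
[cite: DuminilCopinSmirnov2012, §1 "mid-edges of ℍ, i.e. centers of edges"] -/
def hexMidpoint : Sym2 HexVertex → ℂ :=
  Sym2.lift ⟨fun f g => (hexCenter f + hexCenter g) / 2, fun f g => by simp only [add_comm]⟩

/-- `hexMidpoint` on a pair. [folklore] -/
@[simp] theorem hexMidpoint_mk (f g : HexVertex) :
    hexMidpoint s(f, g) = (hexCenter f + hexCenter g) / 2 := rfl

/-- The mid-edges of the hexagonal-lattice domain `Ω` with vertex set `Λ = V(Ω)`: "a mid-edge
`z` belongs to `Ω` if at least one end-point of its associated edge is in" `V(Ω)`.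
[cite: DuminilCopinSmirnov2012, §2 (domains)] -/
def hexDomainMidEdges (Λ : Finset HexVertex) : Set (Sym2 HexVertex) :=
  {e | e ∈ hexGraph.edgeSet ∧ ∃ v ∈ e, v ∈ Λ}

/-- The boundary mid-edges `∂Ω`: edges of `ℍ` with exactly one endpoint in `Λ = V(Ω)` ("it
belongs to `∂Ω` if only one of them is in `Ω`"). [cite: DuminilCopinSmirnov2012, §2 (domains)] -/
def hexDomainBoundary (Λ : Finset HexVertex) : Set (Sym2 HexVertex) :=
  {e | e ∈ hexGraph.edgeSet ∧ ∃ u v : HexVertex, e = s(u, v) ∧ v ∈ Λ ∧ u ∉ Λ}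

/-- `∂Ω ⊆ Ω`. [cite: DuminilCopinSmirnov2012, §2 (domains)] -/
theorem hexDomainBoundary_subset (Λ : Finset HexVertex) :
    hexDomainBoundary Λ ⊆ hexDomainMidEdges Λ := by
  rintro e ⟨he, u, v, rfl, hv, -⟩
  exact ⟨he, v, Sym2.mem_mk_right u v, hv⟩

/-- The domain with vertex set `Λ` is *simply connected*: "having a connected complement", i.e.
the subgraph of `ℍ` induced on `Λᶜ` is preconnected. [cite: DuminilCopinSmirnov2012, §2 (domains)] -/
def hexDomainSimplyConnected (Λ : Finset HexVertex) : Prop :=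
  (hexGraph.induce ((↑Λ : Set HexVertex)ᶜ)).Preconnected

/-! ### Self-avoiding walks between mid-edges -/

/-- **A self-avoiding walk `γ ⊂ Ω : a → z` between the mid-edges `a` and `z`** of the
hexagonal-lattice domain with vertex set `Λ = V(Ω)`, encoded by the list `verts = [v₁, …, vₙ]`
of the vertices it visits, in order: the walk is `mid(a) → v₁ → ⋯ → vₙ → mid(z)`. Conditions:
all `vᵢ ∈ Λ`, pairwise distinct ("visiting every vertex at most once"), consecutive ones
adjacent in `ℍ`; `v₁` is an endpoint of `a` and `vₙ` of `z`; the edges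
`a, {v₁,v₂}, …, {vₙ₋₁,vₙ}, z` used are pairwise distinct (no U-turn inside an edge); the empty
list (the trivial walk, `ℓ = 0`) only for `a = z`; and `a` is a mid-edge of `Ω`.
[cite: DuminilCopinSmirnov2012, §1–§2 (walks between mid-edges)] -/
@[ext] structure HexMidEdgeSAW (Λ : Finset HexVertex) (a z : Sym2 HexVertex) where
  /-- the visited vertices `v₁, …, vₙ`, in order -/
  verts : List HexVertex
  /-- the walk stays in the domain -/
  subset : ∀ v ∈ verts, v ∈ Λ
  /-- self-avoiding -/
  nodup : verts.Nodup
  /-- consecutive vertices are adjacent in `ℍ` -/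
  isChain : verts.IsChain hexGraph.Adj
  /-- the walk starts on the mid-edge `a` -/
  head_mem : ∀ v, verts.head? = some v → v ∈ a
  /-- the walk ends on the mid-edge `z` -/
  getLast_mem : ∀ v, verts.getLast? = some v → v ∈ z
  /-- the trivial walk goes from `a` to `a` -/
  eq_of_nil : verts = [] → a = z
  /-- no edge (or half-edge) is traversed twice -/
  edges_nodup : verts ≠ [] →
    (a :: List.zipWith (fun u w => s(u, w)) verts verts.tail ++ [z]).Nodup
  /-- `a` is a mid-edge of `Ω` -/
  fst_mem : a ∈ hexDomainMidEdges Λ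

namespace HexMidEdgeSAW

variable {Λ : Finset HexVertex} {a z : Sym2 HexVertex}

/-- `ℓ(γ)`, "the number of vertices visited by `γ`". [cite: DuminilCopinSmirnov2012, §1] -/
def length (γ : HexMidEdgeSAW Λ a z) : ℕ := γ.verts.length

/-- The embedded polyline `mid(a), c(v₁), …, c(vₙ), mid(z)` traced by the walk.
[cite: DuminilCopinSmirnov2012, §2 Fig. 1] -/
def points (γ : HexMidEdgeSAW Λ a z) : List ℂ :=
  hexMidpoint a :: γ.verts.map hexCenter ++ [hexMidpoint z]

/-- **The winding `W_γ(a, z)`**: "the total rotation of the direction in radians when `γ` is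
traversed from `a` to" `z` — the sum of the signed turning angles of the polyline `points`
(one turn of `±π/3` at each visited vertex). [cite: DuminilCopinSmirnov2012, §2 (winding)] -/
def winding (γ : HexMidEdgeSAW Λ a z) : ℝ := Literature.Probability.LatticeModels.winding γ.points

/-- The complex weight `e^{-iσ W_γ(a,z)} x^{ℓ(γ)}` of a walk in the parafermionic observable.
[cite: DuminilCopinSmirnov2012, Def. 1] -/
def weight (γ : HexMidEdgeSAW Λ a z) (x σ : ℝ) : ℂ :=
  Complex.exp (-Complex.I * σ * (γ.winding : ℝ)) * (x : ℂ) ^ γ.length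

/-- The trivial walk `a → a` (no vertex visited, `ℓ = 0`). [cite: DuminilCopinSmirnov2012, §1] -/
def trivial (ha : a ∈ hexDomainMidEdges Λ) : HexMidEdgeSAW Λ a a where
  verts := []
  subset := by simp
  nodup := List.nodup_nil
  isChain := List.isChain_nil
  head_mem := by simp
  getLast_mem := by simp
  eq_of_nil _ := rfl
  edges_nodup h := (h rfl).elim
  fst_mem := ha

/-- The trivial walk has length `0`. [folklore] -/
@[simp] theorem length_trivial (ha : a ∈ hexDomainMidEdges Λ) : (trivial ha).length = 0 := rfl

/-- The trivial walk has winding `0`. [folklore] -/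
@[simp] theorem winding_trivial (ha : a ∈ hexDomainMidEdges Λ) : (trivial ha).winding = 0 := by
  simp [winding, points, trivial]

/-- The trivial walk has weight `1`. [folklore] -/
@[simp] theorem weight_trivial (ha : a ∈ hexDomainMidEdges Λ) (x σ : ℝ) :
    (trivial ha).weight x σ = 1 := by
  simp [weight]

/-- There are finitely many self-avoiding walks in a finite domain (they inject into the
duplicate-free lists over `Λ`). [folklore] -/
instance instFinite : Finite (HexMidEdgeSAW Λ a z) := by
  classical
  refine Finite.of_injective
    (fun γ => (⟨γ.verts.attachWith (· ∈ Λ) γ.subset, ?_⟩ : {l : List ↥Λ // l.Nodup})) ?_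
  · refine List.Nodup.of_map Subtype.val ?_
    rw [List.attachWith_map_subtype_val]
    exact γ.nodup
  · intro γ γ' h
    have h' := congrArg (fun l : {l : List ↥Λ // l.Nodup} => l.1.map Subtype.val) h
    simp only [List.attachWith_map_subtype_val] at h'
    exact HexMidEdgeSAW.ext h'

/-- `Fintype` structure on the walks (noncomputable, from finiteness). [folklore] -/
instance instFintype : Fintype (HexMidEdgeSAW Λ a z) := Fintype.ofFinite _

/-- For a boundary mid-edge `a ∈ ∂Ω` the only walk `a → a` is the trivial one: a nonempty walk
would start and end at the unique endpoint of `a` in `Λ`, hence consist of that single vertex,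
and then use the half-edge `a` twice. [cite: DuminilCopinSmirnov2012, §3 proof of Lemma 2 ("F(a) = 1")] -/
theorem verts_eq_nil_of_mem_boundary (ha : a ∈ hexDomainBoundary Λ) (γ : HexMidEdgeSAW Λ a a) :
    γ.verts = [] := by
  obtain ⟨-, u, v, rfl, hv, hu⟩ := ha
  by_contra hne
  -- the first and last vertices are the endpoint `v` of `a` lying in `Λ`
  have key : ∀ w ∈ γ.verts, w ∈ s(u, v) → w = v := by
    intro w hw hwa
    rcases Sym2.mem_iff.1 hwa with rfl | rfl
    · exact absurd (γ.subset _ hw) hu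
    · rfl
  obtain ⟨w, l, hwl⟩ := List.exists_cons_of_ne_nil hne
  have hw : w = v := key w (by simp [hwl]) (γ.head_mem w (by simp [hwl]))
  subst hw
  -- the list is the singleton `[w]`
  have hl : l = [] := by
    by_contra hl
    have hlast : (w :: l).getLast (List.cons_ne_nil _ _) = w := by
      refine key _ ?_ (γ.getLast_mem _ ?_)
      · rw [hwl]; exact List.getLast_mem _
      · rw [hwl]; exact List.getLast?_eq_some_getLast _
    rw [List.getLast_cons hl] at hlast
    have hmem : w ∈ l := hlast ▸ List.getLast_mem hl
    have hnd := γ.nodup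
    rw [hwl, List.nodup_cons] at hnd
    exact hnd.1 hmem
  subst hl
  have hed := γ.edges_nodup hne
  rw [hwl] at hed
  simp at hed

/-- The norm of the weight is `x^{ℓ(γ)}` (`x ≥ 0`): the winding factor is unimodular. [folklore] -/
theorem norm_weight (γ : HexMidEdgeSAW Λ a z) {x : ℝ} (hx : 0 ≤ x) (σ : ℝ) :
    ‖γ.weight x σ‖ = x ^ γ.length := by
  rw [weight, norm_mul, Complex.norm_exp, norm_pow, Complex.norm_real, Real.norm_of_nonneg hx]
  simp

/-- At spin `σ = 0` the weight is `x^{ℓ(γ)}`. [folklore] -/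
theorem weight_zero_spin (γ : HexMidEdgeSAW Λ a z) (x : ℝ) :
    γ.weight x 0 = (x : ℂ) ^ γ.length := by
  simp [weight]

end HexMidEdgeSAW

/-! ### The observable -/

/-- **The SAW parafermionic observable on the hexagonal lattice** (Duminil-Copin–Smirnov 2012,
Definition 1): for the domain with vertex set `Λ = V(Ω)`, a mid-edge `a` (intended `a ∈ ∂Ω`),
fugacity `x`, spin `σ` and a mid-edge `z`,
`F(z) = F(a, z, x, σ) = Σ_{γ ⊂ Ω : a → z} e^{-iσ W_γ(a,z)} x^{ℓ(γ)}`, the (finite) sum running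
over the self-avoiding walks of `Ω` from `a` to `z`. [cite: DuminilCopinSmirnov2012, Def. 1] -/
def hexParafermionicObservable (Λ : Finset HexVertex) (a : Sym2 HexVertex) (x σ : ℝ)
    (z : Sym2 HexVertex) : ℂ :=
  ∑ γ : HexMidEdgeSAW Λ a z, γ.weight x σ

/-- NAMED FACT — **Duminil-Copin–Smirnov 2012, Lemma 1** (the vertex relation; "half of the
discrete Cauchy–Riemann relations"): "If `x = x_c` and `σ = 5/8`, then `F` satisfies the
following relation for every vertex `v ∈ V(Ω)`: `(p - v)F(p) + (q - v)F(q) + (r - v)F(r) = 0`,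
where `p, q, r` are the mid-edges of the three edges adjacent to `v`", for a simply connected
domain `Ω` and `a ∈ ∂Ω` (standing hypotheses of §2), `x_c = 1/√(2+√2)`. Here `p, q, r` are the
three (pairwise distinct) neighbours of `v` in `ℍ`, the mid-edges being `{v,p}, {v,q}, {v,r}`
with positions `hexMidpoint`, and `v` enters through `hexCenter v`. A finite combinatorial
identity (pairs and triplets of walks cancel); vendored as a statement, users take
`(h : DuminilCopinSmirnov2012_lemma1)`. [cite: DuminilCopinSmirnov2012, Lemma 1] -/
def DuminilCopinSmirnov2012_lemma1 : Prop :=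
  ∀ (Λ : Finset HexVertex), hexDomainSimplyConnected Λ →
    ∀ a ∈ hexDomainBoundary Λ, ∀ v ∈ Λ, ∀ p q r : HexVertex,
      hexGraph.Adj v p → hexGraph.Adj v q → hexGraph.Adj v r → p ≠ q → q ≠ r → p ≠ r →
        (hexMidpoint s(v, p) - hexCenter v) *
            hexParafermionicObservable Λ a (Real.sqrt (2 + Real.sqrt 2))⁻¹ (5 / 8) s(v, p) +
          (hexMidpoint s(v, q) - hexCenter v) *
            hexParafermionicObservable Λ a (Real.sqrt (2 + Real.sqrt 2))⁻¹ (5 / 8) s(v, q) +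
          (hexMidpoint s(v, r) - hexCenter v) *
            hexParafermionicObservable Λ a (Real.sqrt (2 + Real.sqrt 2))⁻¹ (5 / 8) s(v, r) = 0

/-! ### API -/

/-- Unfolding the observable. [cite: DuminilCopinSmirnov2012, Def. 1] -/
theorem hexParafermionicObservable_def (Λ : Finset HexVertex) (a : Sym2 HexVertex) (x σ : ℝ)
    (z : Sym2 HexVertex) :
    hexParafermionicObservable Λ a x σ z = ∑ γ : HexMidEdgeSAW Λ a z, γ.weight x σ := rfl

/-- **`F(a) = 1`** for a boundary mid-edge `a ∈ ∂Ω`: the only walk from `a` to `a` is the trivial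
one, of length `0` and winding `0` (used in DCS's proof of Lemma 2: "`Σ_{z∈α} F(z) = F(a) + … =
1 + …`"). [cite: DuminilCopinSmirnov2012, §3 proof of Lemma 2] -/
theorem hexParafermionicObservable_self {Λ : Finset HexVertex} {a : Sym2 HexVertex}
    (ha : a ∈ hexDomainBoundary Λ) (x σ : ℝ) :
    hexParafermionicObservable Λ a x σ a = 1 := by
  have hmem : a ∈ hexDomainMidEdges Λ := hexDomainBoundary_subset Λ ha
  letI : Unique (HexMidEdgeSAW Λ a a) :=
    ⟨⟨HexMidEdgeSAW.trivial hmem⟩, fun γ =>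
      HexMidEdgeSAW.ext (HexMidEdgeSAW.verts_eq_nil_of_mem_boundary ha γ)⟩
  rw [hexParafermionicObservable, Fintype.sum_unique]
  exact HexMidEdgeSAW.weight_trivial hmem x σ

/-- **`|F(z)| ≤ Σ_{γ ⊂ Ω : a → z} x^{ℓ(γ)}`** for `x ≥ 0` (triangle inequality; the winding
factors are unimodular). [folklore] -/
theorem norm_hexParafermionicObservable_le (Λ : Finset HexVertex) (a : Sym2 HexVertex) {x : ℝ}
    (hx : 0 ≤ x) (σ : ℝ) (z : Sym2 HexVertex) :
    ‖hexParafermionicObservable Λ a x σ z‖ ≤ ∑ γ : HexMidEdgeSAW Λ a z, x ^ γ.length := by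
  refine (norm_sum_le _ _).trans (le_of_eq ?_)
  exact Finset.sum_congr rfl fun γ _ => γ.norm_weight hx σ

/-- At spin `σ = 0` the observable is the generating function `Σ_{γ ⊂ Ω : a → z} x^{ℓ(γ)}` of the
walks from `a` to `z`. [folklore] -/
theorem hexParafermionicObservable_zero_spin (Λ : Finset HexVertex) (a : Sym2 HexVertex) (x : ℝ)
    (z : Sym2 HexVertex) :
    hexParafermionicObservable Λ a x 0 z =
      ((∑ γ : HexMidEdgeSAW Λ a z, x ^ γ.length : ℝ) : ℂ) := by
  rw [hexParafermionicObservable, Complex.ofReal_sum]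
  exact Finset.sum_congr rfl fun γ _ => by rw [γ.weight_zero_spin, Complex.ofReal_pow]

/-- Without walks the observable vanishes, e.g. when `a` is not a mid-edge of `Ω`. [folklore] -/
theorem hexParafermionicObservable_eq_zero_of_not_mem {Λ : Finset HexVertex} {a : Sym2 HexVertex}
    (ha : a ∉ hexDomainMidEdges Λ) (x σ : ℝ) (z : Sym2 HexVertex) :
    hexParafermionicObservable Λ a x σ z = 0 := by
  haveI : IsEmpty (HexMidEdgeSAW Λ a z) := ⟨fun γ => ha γ.fst_mem⟩
  simp [hexParafermionicObservable]

end Literature.Probability.RandomPlanarGeometry.SAW
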